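import Summits.QuantumFields.YangMills.Theorems.ConvexGribovBodyContinuumLegGivenGapStubObsGeometry
import Summits.QuantumFields.YangMills.Theorems.ConvexGribovBodyContinuumLegGivenGapStubRpShift
import Summits.QuantumFields.YangMills.Theorems.ConvexGribovBodyContinuumLegGivenGapCsclTorusForms
import HarnessLib

/-!
# `ContinuumLegGivenGap` (stmt-QuantumFields-15828), line `Sketch`, reshape 17-CS, helper 5 of `stub_csclOfLock`:
# lattice representatives as local gauge-invariant observables with prescribed supports; the complex
# self-correlation is a sum of four real connected correlations

For a species `P : YMSpecies G`, real weights `wt` on a finite set `B` of `n`-tuples of sites and a centring constant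
`m̄`, the function `V ↦ ∑_{x ∈ B} wt x ∏ᵢ (P(τ_{xᵢ}V) − m̄)` is gauge invariant, measurable, bounded, and a cylinder on
any edge set `Λ` containing the translated supports of the tuples with non-zero weight (`cscl_rep_*`); hence it is
the underlying function of a `YMSpecies` with support EXACTLY `Λ` (`cscl_rep_species`), and so is its bond reflection
with the reflected support (`cscl_rep_species_reflect`, via the landed `obsGeometry_species_reflect`). For a complex
observable written as `Z = Z₁ + i Z₂` with real bounded measurable parts, the reflected connected self-correlation
`∫ conj Z(ΘŨ) Z(τⁿŨ) − |⟨Z⟩|²` is the signed sum of the four real connected correlations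
`latticeConnectedCorr ρ β (2S+1) (Zᵢ ∘ Θ) Zⱼ n` (`cscl_selfCorr_eq`), hence bounded by the sum of their moduli
(`cscl_selfCorr_le`). Registered anchor: `cscl_anchor_obs`. No definitions. [folklore]
-/

noncomputable section

open scoped ComplexConjugate
open MeasureTheory Filter
open Literature.MathematicalPhysics.QuantumFieldTheory Literature.MathematicalPhysics.QuantumLattice
open Summit.QuantumFields.YangMills.Theorems.ClusteringToYangMills.Reconstructible

namespace Summit.QuantumFields.YangMills.Theorems.ContinuumLegGivenGap

section Rep

variable {G : Type} [Group G] [MeasurableSpace G]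

/-- Gauge invariance of the weighted sum of products of translated species values. [folklore] -/
theorem cscl_rep_gaugeInvariant (P : YMSpecies G) {n : ℕ} (B : Finset (Fin n → Literature.Probability.LatticeModels.Site 4))
    (wt : (Fin n → Literature.Probability.LatticeModels.Site 4) → ℝ) (mb : ℝ) :
    IsZdGaugeInvariant fun V : LGConfig 4 G => ∑ x ∈ B, wt x * ∏ i, (P.F (configShift (-(x i)) V) - mb) := by
  intro g U
  refine Finset.sum_congr rfl fun x _ => ?_
  congr 1
  refine Finset.prod_congr rfl fun i _ => ?_
  have h := obsGeometry_isZdGaugeInvariant_comp_configShift P.gaugeInvariant (-(x i)) g U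
  simp only [Function.comp_apply] at h
  rw [h]

/-- Measurability of the weighted sum of products. [folklore] -/
theorem cscl_rep_measurable (P : YMSpecies G) {n : ℕ} (B : Finset (Fin n → Literature.Probability.LatticeModels.Site 4))
    (wt : (Fin n → Literature.Probability.LatticeModels.Site 4) → ℝ) (mb : ℝ) :
    Measurable fun V : LGConfig 4 G => ∑ x ∈ B, wt x * ∏ i, (P.F (configShift (-(x i)) V) - mb) := by
  refine Finset.measurable_sum _ fun x _ => (Finset.measurable_prod _ fun i _ => ?_).const_mul _
  exact (P.measurable.comp (configShift _).measurable).sub_const _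

/-- Boundedness of the weighted sum of products: `≤ ∑ |wt x| (C_P + |m̄|)ⁿ`. [folklore] -/
theorem cscl_rep_bounded (P : YMSpecies G) {n : ℕ} (B : Finset (Fin n → Literature.Probability.LatticeModels.Site 4))
    (wt : (Fin n → Literature.Probability.LatticeModels.Site 4) → ℝ) (mb : ℝ) {CP : ℝ} (hCP : ∀ U, |P.F U| ≤ CP) :
    ∀ V : LGConfig 4 G, |∑ x ∈ B, wt x * ∏ i, (P.F (configShift (-(x i)) V) - mb)| ≤
      (∑ x ∈ B, |wt x|) * (CP + |mb|) ^ n := by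
  intro V
  rw [Finset.sum_mul]
  refine (Finset.abs_sum_le_sum_abs _ _).trans (Finset.sum_le_sum fun x _ => ?_)
  rw [abs_mul, Finset.abs_prod]
  refine mul_le_mul_of_nonneg_left ?_ (abs_nonneg _)
  calc ∏ i, |P.F (configShift (-(x i)) V) - mb| ≤ ∏ _i : Fin n, (CP + |mb|) :=
        Finset.prod_le_prod (fun i _ => abs_nonneg _) fun i _ => (abs_sub _ _).trans (add_le_add (hCP _) le_rfl)
    _ = (CP + |mb|) ^ n := by simp

/-- **Cylinder property**: if `Λ` contains the translated support `P.supp + xᵢ` of every tuple `x ∈ B` of non-zero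
weight, the weighted sum of products is a cylinder on `Λ`. [folklore] -/
theorem cscl_rep_isCylinder (P : YMSpecies G) {n : ℕ} (B : Finset (Fin n → Literature.Probability.LatticeModels.Site 4))
    (wt : (Fin n → Literature.Probability.LatticeModels.Site 4) → ℝ) (mb : ℝ)
    {Λ : Finset (Literature.MathematicalPhysics.QuantumLattice.ZdEdge 4)}
    (hΛ : ∀ x ∈ B, wt x ≠ 0 → ∀ i, ∀ e ∈ P.supp, (e.1 + x i, e.2) ∈ Λ) :
    IsCylinder (fun V : LGConfig 4 G => ∑ x ∈ B, wt x * ∏ i, (P.F (configShift (-(x i)) V) - mb)) Λ := by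
  intro U V hUV
  refine Finset.sum_congr rfl fun x hx => ?_
  by_cases hw : wt x = 0
  · simp [hw]
  congr 1
  refine Finset.prod_congr rfl fun i _ => ?_
  congr 1
  refine P.isCylinder fun e he => ?_
  simp only [Literature.MathematicalPhysics.QuantumLattice.configShift_apply]
  have h1 : e.1 - -(x i) = e.1 + x i := by funext j; simp
  rw [h1]
  exact hUV _ (Finset.mem_coe.2 (hΛ x hx hw i e (Finset.mem_coe.1 he)))

/-- **Packaging as a species with prescribed support.** [folklore] -/
theorem cscl_rep_species (P : YMSpecies G) {n : ℕ} (B : Finset (Fin n → Literature.Probability.LatticeModels.Site 4))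
    (wt : (Fin n → Literature.Probability.LatticeModels.Site 4) → ℝ) (mb : ℝ)
    {Λ : Finset (Literature.MathematicalPhysics.QuantumLattice.ZdEdge 4)}
    (hΛ : ∀ x ∈ B, wt x ≠ 0 → ∀ i, ∀ e ∈ P.supp, (e.1 + x i, e.2) ∈ Λ) :
    ∃ O : YMSpecies G, (O.F = fun V => ∑ x ∈ B, wt x * ∏ i, (P.F (configShift (-(x i)) V) - mb)) ∧ O.supp = Λ := by
  obtain ⟨CP, hCP⟩ := P.bounded
  exact ⟨⟨fun V => ∑ x ∈ B, wt x * ∏ i, (P.F (configShift (-(x i)) V) - mb), Λ,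
    cscl_rep_isCylinder P B wt mb hΛ, cscl_rep_gaugeInvariant P B wt mb,
    ⟨_, cscl_rep_bounded P B wt mb hCP⟩, cscl_rep_measurable P B wt mb⟩, rfl, rfl⟩

/-- **The bond reflection of the representative as a species with the reflected support.** [folklore] -/
theorem cscl_rep_species_reflect [MeasurableInv G] (P : YMSpecies G) {n : ℕ}
    (B : Finset (Fin n → Literature.Probability.LatticeModels.Site 4))
    (wt : (Fin n → Literature.Probability.LatticeModels.Site 4) → ℝ) (mb : ℝ)
    {Λ : Finset (Literature.MathematicalPhysics.QuantumLattice.ZdEdge 4)}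
    (hΛ : ∀ x ∈ B, wt x ≠ 0 → ∀ i, ∀ e ∈ P.supp, (e.1 + x i, e.2) ∈ Λ) :
    ∃ O : YMSpecies G, (O.F = fun V => ∑ x ∈ B, wt x * ∏ i, (P.F (configShift (-(x i)) (gaugeTimeReflect V)) - mb)) ∧
      O.supp = Λ.image (fun e => if e.2 = 0 then (latticeTimeReflection 4 (e.1 + Pi.single 0 1), 0)
        else (latticeTimeReflection 4 e.1, e.2)) := by
  obtain ⟨O, hOF, hOs⟩ := cscl_rep_species P B wt mb hΛ
  obtain ⟨O', hO'F, hO's⟩ := obsGeometry_species_reflect O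
  refine ⟨O', ?_, by rw [hO's, hOs]⟩
  rw [hO'F, hOF]
  rfl

end Rep

/-! ### The complex self-correlation as four real connected correlations -/

section Corr

variable {G : Type} [Group G] [TopologicalSpace G] [IsTopologicalGroup G] [CompactSpace G]
  [MeasurableSpace G] [BorelSpace G] {N : ℕ} (ρ : G →* Matrix (Fin N) (Fin N) ℂ)

/-- **`∫ conj Z(ΘŨ) Z(τⁿŨ) − |⟨Z⟩|²` for `Z = Z₁ + iZ₂`** is
`corr(Z₁∘Θ, Z₁; n) + corr(Z₂∘Θ, Z₂; n) + i (corr(Z₁∘Θ, Z₂; n) − corr(Z₂∘Θ, Z₁; n))`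
with `corr = latticeConnectedCorr ρ β (2S+1)` (reflection invariance for the means of the reflected parts). [folklore] -/
theorem cscl_selfCorr_eq (hρ : Continuous ρ) (β : ℝ) (S : ℕ) {Z₁ Z₂ : LGConfig 4 G → ℝ}
    (h1m : Measurable Z₁) (h2m : Measurable Z₂) (h1b : ∃ C : ℝ, ∀ U, |Z₁ U| ≤ C) (h2b : ∃ C : ℝ, ∀ U, |Z₂ U| ≤ C)
    (n : ℕ) :
    (∫ U, conj ((Z₁ (gaugeTimeReflect (torusLift (2 * S + 1) U)) : ℂ) + Complex.I * (Z₂ (gaugeTimeReflect (torusLift (2 * S + 1) U)) : ℂ)) * ((Z₁ (configShift (-(Pi.single 0 (n : ℤ))) (torusLift (2 * S + 1) U)) : ℂ) + Complex.I * (Z₂ (configShift (-(Pi.single 0 (n : ℤ))) (torusLift (2 * S + 1) U)) : ℂ)) ∂(wilsonMeasure (d := 4) (L := 2 * S + 1) ρ β)) -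
      conj (∫ V, ((Z₁ (torusLift (2 * S + 1) V) : ℂ) + Complex.I * (Z₂ (torusLift (2 * S + 1) V) : ℂ)) ∂(wilsonMeasure (d := 4) (L := 2 * S + 1) ρ β)) * (∫ V, ((Z₁ (torusLift (2 * S + 1) V) : ℂ) + Complex.I * (Z₂ (torusLift (2 * S + 1) V) : ℂ)) ∂(wilsonMeasure (d := 4) (L := 2 * S + 1) ρ β)) =
      ((latticeConnectedCorr ρ β (2 * S + 1) (Z₁ ∘ gaugeTimeReflect) Z₁ n +
          latticeConnectedCorr ρ β (2 * S + 1) (Z₂ ∘ gaugeTimeReflect) Z₂ n : ℝ) : ℂ) +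
        Complex.I * ((latticeConnectedCorr ρ β (2 * S + 1) (Z₁ ∘ gaugeTimeReflect) Z₂ n -
          latticeConnectedCorr ρ β (2 * S + 1) (Z₂ ∘ gaugeTimeReflect) Z₁ n : ℝ) : ℂ) := by
  haveI := isProbabilityMeasure_wilsonMeasure (d := 4) (L := 2 * S + 1) ρ hρ β
  obtain ⟨C1, hC1⟩ := h1b
  obtain ⟨C2, hC2⟩ := h2b
  -- real integrability facts
  have hint : ∀ {f : GaugeConfig 4 (2 * S + 1) G → ℝ}, Measurable f → (∃ C : ℝ, ∀ U, |f U| ≤ C) → Integrable f (wilsonMeasure (d := 4) (L := 2 * S + 1) ρ β) := by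
    intro f hf hb
    obtain ⟨C, hC⟩ := hb
    exact Integrable.of_bound hf.aestronglyMeasurable C (Eventually.of_forall fun U => by
      rw [Real.norm_eq_abs]; exact hC U)
  have mR : ∀ {Z : LGConfig 4 G → ℝ}, Measurable Z → Measurable fun U : GaugeConfig 4 (2 * S + 1) G =>
      Z (gaugeTimeReflect (torusLift (2 * S + 1) U)) := fun hZ =>
    hZ.comp (measurable_gaugeTimeReflect.comp (measurable_torusLift _))
  have mT : ∀ {Z : LGConfig 4 G → ℝ}, Measurable Z → Measurable fun U : GaugeConfig 4 (2 * S + 1) G =>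
      Z (configShift (-(Pi.single 0 (n : ℤ))) (torusLift (2 * S + 1) U)) := fun hZ =>
    hZ.comp ((configShift _).measurable.comp (measurable_torusLift _))
  have mL : ∀ {Z : LGConfig 4 G → ℝ}, Measurable Z → Measurable fun U : GaugeConfig 4 (2 * S + 1) G =>
      Z (torusLift (2 * S + 1) U) := fun hZ => hZ.comp (measurable_torusLift _)
  -- means and reflected means
  -- expand everything into real integrals
  have hI : ∀ (A B : LGConfig 4 G → ℝ), Measurable A → Measurable B → (∃ C : ℝ, ∀ U, |A U| ≤ C) →
      (∃ C : ℝ, ∀ U, |B U| ≤ C) →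
      Integrable (fun U : GaugeConfig 4 (2 * S + 1) G => A (gaugeTimeReflect (torusLift (2 * S + 1) U)) *
        B (configShift (-(Pi.single 0 (n : ℤ))) (torusLift (2 * S + 1) U))) (wilsonMeasure (d := 4) (L := 2 * S + 1) ρ β) := by
    intro A B hA hB hAb hBb
    obtain ⟨CA, hCA⟩ := hAb; obtain ⟨CB, hCB⟩ := hBb
    refine hint ((mR hA).mul (mT hB)) ⟨CA * CB, fun U => ?_⟩
    rw [abs_mul]
    have hCA0 : 0 ≤ CA := (abs_nonneg _).trans (hCA (gaugeTimeReflect (torusLift (2 * S + 1) U)))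
    exact mul_le_mul (hCA _) (hCB _) (abs_nonneg _) hCA0
  -- the complex integrand as a combination of real products
  have hpt : ∀ U : GaugeConfig 4 (2 * S + 1) G,
      conj ((Z₁ (gaugeTimeReflect (torusLift (2 * S + 1) U)) : ℂ) + Complex.I * (Z₂ (gaugeTimeReflect (torusLift (2 * S + 1) U)) : ℂ)) * ((Z₁ (configShift (-(Pi.single 0 (n : ℤ))) (torusLift (2 * S + 1) U)) : ℂ) + Complex.I * (Z₂ (configShift (-(Pi.single 0 (n : ℤ))) (torusLift (2 * S + 1) U)) : ℂ)) =
      ((Z₁ (gaugeTimeReflect (torusLift (2 * S + 1) U)) * Z₁ (configShift (-(Pi.single 0 (n : ℤ))) (torusLift (2 * S + 1) U)) + Z₂ (gaugeTimeReflect (torusLift (2 * S + 1) U)) * Z₂ (configShift (-(Pi.single 0 (n : ℤ))) (torusLift (2 * S + 1) U)) : ℝ) : ℂ) +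
        Complex.I * ((Z₁ (gaugeTimeReflect (torusLift (2 * S + 1) U)) * Z₂ (configShift (-(Pi.single 0 (n : ℤ))) (torusLift (2 * S + 1) U)) - Z₂ (gaugeTimeReflect (torusLift (2 * S + 1) U)) * Z₁ (configShift (-(Pi.single 0 (n : ℤ))) (torusLift (2 * S + 1) U)) : ℝ) : ℂ) := by
    intro U
    simp only [map_add, map_mul, Complex.conj_ofReal, Complex.conj_I]
    push_cast
    ring_nf
    rw [Complex.I_sq]
    ring
  simp_rw [hpt]
  have hc1 := hI Z₁ Z₁ h1m h1m ⟨C1, hC1⟩ ⟨C1, hC1⟩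
  have hc2 := hI Z₂ Z₂ h2m h2m ⟨C2, hC2⟩ ⟨C2, hC2⟩
  have hc12 := hI Z₁ Z₂ h1m h2m ⟨C1, hC1⟩ ⟨C2, hC2⟩
  have hc21 := hI Z₂ Z₁ h2m h1m ⟨C2, hC2⟩ ⟨C1, hC1⟩
  have hl1 := hint (mL h1m) ⟨C1, fun U => hC1 _⟩
  have hl2 := hint (mL h2m) ⟨C2, fun U => hC2 _⟩
  rw [integral_add ((hc1.add hc2).ofReal) ((hc12.sub hc21).ofReal.const_mul _), integral_const_mul,
    integral_complex_ofReal, integral_complex_ofReal, integral_add hc1 hc2, integral_sub hc12 hc21,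
    integral_add hl1.ofReal (hl2.ofReal.const_mul _), integral_const_mul, integral_complex_ofReal,
    integral_complex_ofReal]
  -- unfold the four connected correlations
  simp only [latticeConnectedCorr, Function.comp_apply]
  rw [rpShift_integral_gaugeTimeReflect_torusLift ρ hρ β _ Z₁, rpShift_integral_gaugeTimeReflect_torusLift ρ hρ β _ Z₂]
  simp only [map_add, map_mul, Complex.conj_ofReal, Complex.conj_I]
  push_cast
  ring_nf
  rw [Complex.I_sq]
  ring

/-- **Bound of the complex self-correlation by the four real ones.** [folklore] -/
theorem cscl_selfCorr_le (hρ : Continuous ρ) (β : ℝ) (S : ℕ) {Z₁ Z₂ : LGConfig 4 G → ℝ}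
    (h1m : Measurable Z₁) (h2m : Measurable Z₂) (h1b : ∃ C : ℝ, ∀ U, |Z₁ U| ≤ C) (h2b : ∃ C : ℝ, ∀ U, |Z₂ U| ≤ C)
    (n : ℕ) :
    ‖(∫ U, conj ((Z₁ (gaugeTimeReflect (torusLift (2 * S + 1) U)) : ℂ) + Complex.I * (Z₂ (gaugeTimeReflect (torusLift (2 * S + 1) U)) : ℂ)) * ((Z₁ (configShift (-(Pi.single 0 (n : ℤ))) (torusLift (2 * S + 1) U)) : ℂ) + Complex.I * (Z₂ (configShift (-(Pi.single 0 (n : ℤ))) (torusLift (2 * S + 1) U)) : ℂ)) ∂(wilsonMeasure (d := 4) (L := 2 * S + 1) ρ β)) -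
      conj (∫ V, ((Z₁ (torusLift (2 * S + 1) V) : ℂ) + Complex.I * (Z₂ (torusLift (2 * S + 1) V) : ℂ)) ∂(wilsonMeasure (d := 4) (L := 2 * S + 1) ρ β)) * (∫ V, ((Z₁ (torusLift (2 * S + 1) V) : ℂ) + Complex.I * (Z₂ (torusLift (2 * S + 1) V) : ℂ)) ∂(wilsonMeasure (d := 4) (L := 2 * S + 1) ρ β))‖ ≤
      |latticeConnectedCorr ρ β (2 * S + 1) (Z₁ ∘ gaugeTimeReflect) Z₁ n| +
        |latticeConnectedCorr ρ β (2 * S + 1) (Z₂ ∘ gaugeTimeReflect) Z₂ n| +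
        |latticeConnectedCorr ρ β (2 * S + 1) (Z₁ ∘ gaugeTimeReflect) Z₂ n| +
        |latticeConnectedCorr ρ β (2 * S + 1) (Z₂ ∘ gaugeTimeReflect) Z₁ n| := by
  rw [cscl_selfCorr_eq ρ hρ β S h1m h2m h1b h2b n]
  refine (norm_add_le _ _).trans ?_
  rw [norm_mul, Complex.norm_I, one_mul, Complex.norm_real, Complex.norm_real, Real.norm_eq_abs, Real.norm_eq_abs]
  have h1 := abs_add_le (latticeConnectedCorr ρ β (2 * S + 1) (Z₁ ∘ gaugeTimeReflect) Z₁ n)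
    (latticeConnectedCorr ρ β (2 * S + 1) (Z₂ ∘ gaugeTimeReflect) Z₂ n)
  have h2 := abs_sub (latticeConnectedCorr ρ β (2 * S + 1) (Z₁ ∘ gaugeTimeReflect) Z₂ n)
    (latticeConnectedCorr ρ β (2 * S + 1) (Z₂ ∘ gaugeTimeReflect) Z₁ n)
  linarith

end Corr

/-- **Registered anchor of this file** (closed form of `cscl_rep_gaugeInvariant`, for the gate's `--supports` stub
check). [folklore] -/
theorem cscl_anchor_obs :
    ∀ (G : Type) [Group G] [MeasurableSpace G] (P : YMSpecies G) (n : ℕ)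
      (B : Finset (Fin n → Literature.Probability.LatticeModels.Site 4))
      (wt : (Fin n → Literature.Probability.LatticeModels.Site 4) → ℝ) (mb : ℝ),
      IsZdGaugeInvariant fun V : LGConfig 4 G => ∑ x ∈ B, wt x * ∏ i, (P.F (configShift (-(x i)) V) - mb) :=
  fun _ _ _ P _ B wt mb => cscl_rep_gaugeInvariant P B wt mb

end Summit.QuantumFields.YangMills.Theorems.ContinuumLegGivenGap

end
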